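import Summits.BirchSwinnertonDyer.Rank1Residual.X1.PadicSigmaThreeUniversalChart
import Literature.NumberTheory.EllipticCurves.UniversalSigmaSpecializationProofs
import HarnessLib

/-!
# `K₃ = R̂₃[1/3]`: the `ℚ`-algebra in which `∫ζ̃ω` and `exp ∫ζ̃ω` of the universal ordinary `a₂`-curve
# live, the extension of endomorphisms and specialisations to it, and Thm 2 over `R̂₃` (module M4a of
# the x1a design for the Mazur–Tate sigma function at `p = 3`)

HONEST FRAMING (cell `b2b-bsdres`, run/shared/lean/b2b/bsd-rank1-residual/, verbatim in every file):
the goal of the cell is to DELETE the COMBINATION-SHAPED residual classes of the Birch–Swinnerton-Dyer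
formula for ALL analytic-rank `≤ 1` elliptic curves over `ℚ` — "full BSD formula for every rank `≤ 1`
curve in class `C`" assembled STRICTLY from published theorems — so that the rank-`≤ 1` remainder
becomes exactly the CONSTRUCTION-SHAPED classes, which are TYPED (missing-input `Prop`s), NOT
attempted. This is not "finishing BSD". CLASS-OWNERS.md row "X1 (r = 1)": research route; NO CLAIM
BEYOND STATED CLASSES; nothing is booked by this file; no preprint enters; no named fact.

Unit `b2b-bsdres-x1a` (X1 prover A, gen 20). Sequel of `X1/PadicSigmaThreeUniversalRing.lean` /
`…UniversalChart.lean` (`R̂₃ = completeRing`, `univChart`, `universalCurve`). This is the tree's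
`UniversalOrdinaryFunctionalEquation.lean` (first half) and the `R̂`-part of
`UniversalSigmaSpecializationProofs.lean`, repeated for `R̂₃`:
* **`completeRingQ = K₃ = R̂₃[1/3]`** (`Localization.Away 3`), `intSubring = R̂₃ ⊆ K₃`, `3 ∈ K₃ˣ`,
  `exists_pow_mul_mem_intSubring` (`K₃ = R̂₃[1/3]`, hypothesis `hK` of Dwork's lemma), every nonzero
  integer a unit, **`Algebra ℚ K₃`**, `R̂₃ → K₃` injective, `K₃` a domain;
* **`extendQ α : K₃ → K₃`** for an endomorphism `α` of `R̂₃`, `extendQ_algebraMap`, `extendQ_mem_intSubring`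
  (`α_K(R̂₃) ⊆ R̂₃`, hypothesis `hαA`), `exists_extendQ_eq_pow_add` (`α ≡ Frob ⇒ α_K(r) = r³ + 3a`,
  hypothesis `hα`);
* **`exists_even_zetaSeries_universalCurve`** — Blakestad–Grant's Thm 2 for the universal ordinary
  `a₂`-curve over `R̂₃` (tree `exists_padicWeierstrassZetaConst` / `…Series`, whose hypotheses are the
  theorems of the prequels: complete, torsion-free, unit Hasse coefficients);
* `exists_ringHom_completeRingQ_padic`, `norm_le_one_of_mem_intSubring` — a specialisation
  `ρ : R̂₃ → ℤ₃` extends to `ρ_K : K₃ → ℚ₃` and carries `R̂₃`-coefficients to `3`-integral ones.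

References: C. Blakestad, D. Grant, J. Number Theory 249 (2023) 348–376, §2.2, Lemma 5, Thm 2, Thm 15
[BlakestadGrant2023]; tree files `UniversalOrdinaryFunctionalEquation.lean`,
`UniversalSigmaSpecializationProofs.lean` (same statements for Blakestad–Grant's `R̂`).
HOME/b2b-bsdres-x1a/gen20/A34-P3-DESIGN.md §4.

Definitions (with bodies): `completeRingQ`, `intSubring`, `extendQ`, `ratCast` (+ the `Algebra ℚ`
instance). No named facts, no `sorry`.
-/

noncomputable section

open PowerSeries

namespace Summit.BirchSwinnertonDyer.Rank1Residual.X1.PadicSigmaThree.Universal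

open Literature.RingTheory.AdicTopology Literature.NumberTheory.EllipticCurves

/-! ## `K₃ = R̂₃[1/3]` -/

/-- **`K₃ = R̂₃[1/3]`**. [cite: BlakestadGrant2023, §2.2] -/
abbrev completeRingQ : Type := Localization.Away (3 : completeRing)

/-- `3` is a unit of `K₃`. [folklore] -/
theorem isUnit_three_completeRingQ : IsUnit (3 : completeRingQ) := by
  have h := IsLocalization.Away.algebraMap_isUnit (S := completeRingQ) (3 : completeRing)
  rwa [map_ofNat] at h

/-- **`R̂₃ ⊆ K₃`** (the range of `R̂₃ → K₃`). [cite: BlakestadGrant2023, §2.2] -/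
abbrev intSubring : Subring completeRingQ := (algebraMap completeRing completeRingQ).range

/-- `K₃ = R̂₃[1/3]`: every element becomes integral after multiplication by a power of `3`. [folklore] -/
theorem exists_pow_mul_mem_intSubring (x : completeRingQ) : ∃ k : ℕ, (3 : completeRingQ) ^ k * x ∈ intSubring := by
  obtain ⟨⟨r, s⟩, h⟩ := IsLocalization.surj (Submonoid.powers (3 : completeRing)) x
  obtain ⟨k, hk⟩ := s.2
  refine ⟨k, r, ?_⟩
  simp only at h
  rw [mul_comm, ← h, ← hk, map_pow, map_ofNat]

/-- The same with `((3 : ℕ) : K₃)` (the form of the tree's Dwork lemma). [folklore] -/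
theorem exists_natCast_pow_mul_mem_intSubring (x : completeRingQ) :
    ∃ k : ℕ, ((3 : ℕ) : completeRingQ) ^ k * x ∈ intSubring :=
  exists_pow_mul_mem_intSubring x

section Extend

variable (α : completeRing →+* completeRing)

/-- A ring endomorphism of `R̂₃` preserves the powers of `3`. [folklore] -/
theorem powers_le_comap : Submonoid.powers (3 : completeRing) ≤ (Submonoid.powers (3 : completeRing)).comap α := by
  rw [Submonoid.powers_le, Submonoid.mem_comap, map_ofNat]
  exact Submonoid.mem_powers _

/-- **The extension `α_K : K₃ → K₃`** of an endomorphism `α` of `R̂₃`. [cite: BlakestadGrant2023, Lemma 5] -/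
def extendQ : completeRingQ →+* completeRingQ :=
  IsLocalization.map completeRingQ α (powers_le_comap α)

/-- `α_K` restricted to `R̂₃` is `α`. [folklore] -/
theorem extendQ_algebraMap (x : completeRing) :
    extendQ α (algebraMap completeRing completeRingQ x) = algebraMap completeRing completeRingQ (α x) :=
  IsLocalization.map_eq (powers_le_comap α) x

/-- `α_K(R̂₃) ⊆ R̂₃`. [folklore] -/
theorem extendQ_mem_intSubring {r : completeRingQ} (hr : r ∈ intSubring) : extendQ α r ∈ intSubring := by
  obtain ⟨x, rfl⟩ := hr
  exact ⟨α x, (extendQ_algebraMap α x).symm⟩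

/-- If `α ≡` Frobenius `(mod 3)` on `R̂₃`, then `α_K(r) = r³ + 3·a` with `a ∈ R̂₃` for `r ∈ R̂₃`.
[cite: BlakestadGrant2023, Def. 8] -/
theorem exists_extendQ_eq_pow_add (hα : ∀ x, α x - x ^ 3 ∈ Ideal.span {(3 : completeRing)})
    {r : completeRingQ} (hr : r ∈ intSubring) :
    ∃ a ∈ intSubring, extendQ α r = r ^ 3 + 3 * a := by
  obtain ⟨x, rfl⟩ := hr
  obtain ⟨y, hy⟩ := Ideal.mem_span_singleton.mp (hα x)
  refine ⟨algebraMap _ _ y, ⟨y, rfl⟩, ?_⟩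
  rw [extendQ_algebraMap, eq_add_of_sub_eq hy, map_add, map_mul, map_pow, map_ofNat, add_comm]

/-- The same in the `((3 : ℕ) : K₃)`-form of the tree's Dwork lemma. [folklore] -/
theorem exists_extendQ_eq_pow_add' (hα : ∀ x, α x - x ^ 3 ∈ Ideal.span {(3 : completeRing)})
    {r : completeRingQ} (hr : r ∈ intSubring) :
    ∃ a ∈ intSubring, extendQ α r = r ^ (3 : ℕ) + ((3 : ℕ) : completeRingQ) * a :=
  exists_extendQ_eq_pow_add α hα hr

end Extend

/-- Every nonzero natural number is a unit of `K₃`. [folklore] -/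
theorem isUnit_natCast_completeRingQ {n : ℕ} (hn : n ≠ 0) : IsUnit (n : completeRingQ) := by
  obtain ⟨k, m, hm, rfl⟩ := Nat.exists_eq_pow_mul_and_not_dvd hn 3 (by norm_num)
  rw [Nat.cast_mul, Nat.cast_pow]
  refine ((isUnit_three_completeRingQ).pow k).mul ?_
  have hmu : IsUnit (m : completeRing) :=
    isUnit_natCast_of_coprime (p := 3) ((Nat.Prime.coprime_iff_not_dvd Nat.prime_three).mpr hm).symm
  simpa using hmu.map (algebraMap completeRing completeRingQ)

/-- Every nonzero integer is a unit of `K₃`. [folklore] -/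
theorem isUnit_intCast_completeRingQ {n : ℤ} (hn : n ≠ 0) : IsUnit (n : completeRingQ) := by
  have h : ((n.sign : ℤ) : completeRingQ) * (n : completeRingQ) = (n.natAbs : ℕ) := by
    rw [← Int.cast_mul, Int.sign_mul_self_eq_natAbs, Int.cast_natCast]
  have hu : IsUnit (((n.sign : ℤ) : completeRingQ) * (n : completeRingQ)) := by
    rw [h]
    exact isUnit_natCast_completeRingQ (Int.natAbs_ne_zero.mpr hn)
  exact isUnit_of_mul_isUnit_right hu

/-- The ring map `ℚ → K₃`. [folklore] -/
def ratCast : ℚ →+* completeRingQ :=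
  IsLocalization.lift (M := nonZeroDivisors ℤ) (S := ℚ) (g := Int.castRingHom completeRingQ)
    fun y => isUnit_intCast_completeRingQ (mem_nonZeroDivisors_iff_ne_zero.mp y.2)

/-- **`K₃` is a `ℚ`-algebra.** [folklore] -/
instance algebraRat_completeRingQ : Algebra ℚ completeRingQ := ratCast.toAlgebra

/-- `3 ≠ 0` in `R̂₃`. [folklore] -/
theorem three_ne_zero : (3 : completeRing) ≠ 0 := by
  intro h0
  have h1 : ((3 : ℕ) : completeRing) ^ 1 * 1 = 0 := by rw [pow_one, mul_one]; exact h0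
  exact one_ne_zero ((pow_mul_eq_zero_iff_completeRing 1 1).mp h1)

/-- **`R̂₃ → K₃` is injective.** [folklore] -/
theorem algebraMap_completeRingQ_injective : Function.Injective (algebraMap completeRing completeRingQ) :=
  IsLocalization.injective completeRingQ (powers_le_nonZeroDivisors_of_noZeroDivisors three_ne_zero)

/-- `K₃` is an integral domain. [folklore] -/
instance isDomain_completeRingQ : IsDomain completeRingQ :=
  IsLocalization.isDomain_localization (powers_le_nonZeroDivisors_of_noZeroDivisors three_ne_zero)

/-- `R̂₃ → K₃` is injective on power series. [folklore] -/
theorem powerSeries_map_algebraMap_injective :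
    Function.Injective (PowerSeries.map (algebraMap completeRing completeRingQ)) :=
  PowerSeries.map_injective _ algebraMap_completeRingQ_injective

/-! ## Thm 2 over `R̂₃` and the `3`-adic side of specialisation -/

/-- **Blakestad–Grant's Thm 2 for the universal ordinary `a₂`-curve at `p = 3`**: there are `β ∈ R̂₃`
and an EVEN series `Λ = 1 + ⋯ ∈ R̂₃⟦z⟧` with `zΛ' - Λ = -(X - βz²)·W_𝓔` (`Dζ = -x + β`, `ζ = Λ/z`).
[cite: BlakestadGrant2023, Thm. 2] -/
theorem exists_even_zetaSeries_universalCurve :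
    ∃ β : completeRing, ∃ Λ : PowerSeries completeRing,
      constantCoeff Λ = 1 ∧ rescale (-1 : completeRing) Λ = Λ ∧
      X * d⁄dX completeRing Λ - Λ = -((universalCurve.formalXMulSq - C β * X ^ 2) * universalCurve.formalInvDiff) := by
  obtain ⟨β, hβ⟩ := universalCurve.exists_padicWeierstrassZetaConst 3 (by norm_num)
    isUnit_coeff_formalInvDiff_universalCurve_pow
  obtain ⟨Λ₀, h0, hΛ₀, -⟩ := universalCurve.exists_padicWeierstrassZetaSeries hβ
  obtain ⟨hΛ₁, h0₁⟩ := zetaSeries_sub_C_mul_X hΛ₀ (coeff 1 Λ₀)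
  refine ⟨β, Λ₀ - C (coeff 1 Λ₀) * X, by rw [h0₁, h0], ?_, hΛ₁⟩
  refine rescale_neg_one_eq_self_of_zetaSeries hΛ₁ (universalCurve.rescale_neg_one_formalXMulSq_sub_mul_formalInvDiff β) ?_
  rw [map_sub, coeff_C_mul, coeff_one_X, mul_one, sub_self]

/-- **`ρ` extends to `K₃`**: a ring map `ρ : R̂₃ → ℤ₃` induces `ρ_K : K₃ → ℚ₃` with `ρ_K|_{R̂₃} = ρ`.
[folklore] -/
theorem exists_ringHom_completeRingQ_padic (ρ : completeRing →+* ℤ_[3]) :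
    ∃ ρK : completeRingQ →+* ℚ_[3], ∀ x, ρK (algebraMap completeRing completeRingQ x) = ((ρ x : ℤ_[3]) : ℚ_[3]) := by
  have hu : IsUnit (((PadicInt.Coe.ringHom (p := 3)).comp ρ) (3 : completeRing)) := by
    rw [map_ofNat]
    exact isUnit_iff_ne_zero.mpr (by norm_num)
  refine ⟨IsLocalization.Away.lift (3 : completeRing) hu, fun x => ?_⟩
  rw [IsLocalization.Away.lift_eq]
  rfl

/-- Coefficients in `R̂₃ ⊆ K₃` specialise to `3`-integral elements of `ℚ₃`. [folklore] -/
theorem norm_le_one_of_mem_intSubring {ρ : completeRing →+* ℤ_[3]} {ρK : completeRingQ →+* ℚ_[3]}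
    (hρK : ∀ x, ρK (algebraMap completeRing completeRingQ x) = ((ρ x : ℤ_[3]) : ℚ_[3]))
    {c : completeRingQ} (hc : c ∈ intSubring) : ‖ρK c‖ ≤ 1 := by
  obtain ⟨x, rfl⟩ := hc
  rw [hρK, ← PadicInt.norm_def]
  exact PadicInt.norm_le_one _

end Summit.BirchSwinnertonDyer.Rank1Residual.X1.PadicSigmaThree.Universal

end
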